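import Mathlib
import Summits.Ventures.PercRepro2.Tail2D
import Summits.Ventures.PercRepro2.Tail2DFlowTwoLemmas
import Summits.Ventures.PercRepro2.Tail2DFlow3M2

/-!
# Necessary conditions for the flow-three parallel step (mine-b g30)

The transport theorem `hconv3_isMTail` gives SUFFICIENT conditions on the ten weights `n_ij` of a
max-flow-3 factor under which the ten-point convolution of every M♮ tail is again an M♮ tail. This
file records the two simplest NECESSARY conditions, read off two explicit M♮ tails:

* the FLAT tail `flat L`, the indicator of the clipped triangle `{a⁺ + b⁺ ≤ L}`, and
* the GEOMETRIC level tail `geom R L`, equal to `R^(L − level)` on the triangle (`1 ≤ R`).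

At a base point of the top level the `m1` defect of the convolution with the flat tail is exactly
`(n00 − m₁)·S − m₁²`, with `m₁ = n10 + n01` the level-one mass and `S` the mass of the levels `≥ 2`;
for the geometric tail it is `(n00 − R·m₁)(m₂ + R·m₃) − m₁²`. Hence every weight vector for which
the ten-point convolution preserves the class — in particular every flow-3 law of the class `𝒴`
(registry §32.2) — satisfies `(n00 − m₁)·S ≤ m₁²` and `(n00 − R·m₁)(m₂ + R·m₃) ≤ m₁²` for every
real `R ≥ 1` (`flow3_necessary`).

The flat tail also explains the obstacle of the wide laws `P(e³) ∧ P(e^d)`: at its top level the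
`m1` coefficient of the pair `{(0,0),(1,2)}` is `1` (`flat_top_orphan_one`) while every pair of two
points of level `≥ 2` has coefficient `0` (`flat_top_high_zero`) — so no absorption inequality of
the form `c{(0,0),(1,2)} + Σ c(I) ≤ 0` with absorbers `I` among the signed pairs containing a
top-level point can hold on all M♮ tails; the weight `n00·n12` of that pair must be paid by the
UNSIGNED pairs `{(0,1),t}`, `{(1,0),t}`. Finally `abs1_orphan_le` bounds that coefficient by the
log-concavity defect of the column through the base point.
-/

namespace Summit.Ventures.PercRepro2.Tail2D

/-- the flat tail: the indicator of the clipped triangle `{a⁺ + b⁺ ≤ L}` -/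
noncomputable def flat (L : ℤ) (a b : ℤ) : ℝ := if max a 0 + max b 0 ≤ L then 1 else 0

/-- the flat tail is an M♮ tail of level `L` -/
theorem flat_isMTail {L : ℤ} (hL : 0 ≤ L) : IsMTail (flat L) L where
  L_nonneg := hL
  clip₁ := by
    intro a b h; unfold flat
    have : max a 0 = max (0 : ℤ) 0 := by omega
    rw [this]
  clip₂ := by
    intro a b h; unfold flat
    have : max b 0 = max (0 : ℤ) 0 := by omega
    rw [this]
  pos := by intro a b h; unfold flat; simp [h]
  zero := by intro a b h; unfold flat; simp [not_le.2 h]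
  anti₁ := by intro a b; unfold flat; split_ifs <;> norm_num; omega
  anti₂ := by intro a b; unfold flat; split_ifs <;> norm_num; omega
  m1 := by intro a b; unfold flat; split_ifs <;> norm_num <;> omega
  m2 := by intro a b; unfold flat; split_ifs <;> norm_num <;> omega
  m4 := by intro a b; unfold flat; split_ifs <;> norm_num <;> omega

/-- the geometric level tail: `R^(L − (a⁺ + b⁺))` on the clipped triangle, `0` outside -/
noncomputable def geom (R : ℝ) (L : ℤ) (a b : ℤ) : ℝ :=
  if max a 0 + max b 0 ≤ L then R ^ (L - (max a 0 + max b 0)).toNat else 0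

/-- `R^m R^n ≤ R^p R^q` for `1 ≤ R` and `m + n ≤ p + q` -/
lemma geom_pow_mul_pow_le {R : ℝ} (hR : 1 ≤ R) {m n p q : ℕ} (h : m + n ≤ p + q) :
    R ^ m * R ^ n ≤ R ^ p * R ^ q := by
  rw [← pow_add, ← pow_add]; exact pow_le_pow_right₀ hR h

/-- the geometric level tail is an M♮ tail of level `L` for every ratio `R ≥ 1` (its logarithm is
affine in the level, so the three exchange inequalities hold with equality away from the clipping) -/
theorem geom_isMTail {R : ℝ} (hR : 1 ≤ R) {L : ℤ} (hL : 0 ≤ L) : IsMTail (geom R L) L where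
  L_nonneg := hL
  clip₁ := by
    intro a b h; unfold geom
    have : max a 0 = max (0 : ℤ) 0 := by omega
    rw [this]
  clip₂ := by
    intro a b h; unfold geom
    have : max b 0 = max (0 : ℤ) 0 := by omega
    rw [this]
  pos := by
    intro a b h; unfold geom; simp only [h, if_true]
    exact pow_pos (by linarith) _
  zero := by intro a b h; unfold geom; simp [not_le.2 h]
  anti₁ := by
    intro a b; unfold geom
    split_ifs with h1 h2 h2
    · exact pow_le_pow_right₀ hR (by omega)
    · exfalso; omega
    · exact pow_nonneg (by linarith) _
    · exact le_rfl
  anti₂ := by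
    intro a b; unfold geom
    split_ifs with h1 h2 h2
    · exact pow_le_pow_right₀ hR (by omega)
    · exfalso; omega
    · exact pow_nonneg (by linarith) _
    · exact le_rfl
  m1 := by
    intro a b; unfold geom
    have hR0 : (0 : ℝ) ≤ R := by linarith
    split_ifs <;> first
      | exact geom_pow_mul_pow_le hR (by omega)
      | (exfalso; omega)
      | (simp <;> positivity)
  m2 := by
    intro a b; unfold geom
    have hR0 : (0 : ℝ) ≤ R := by linarith
    split_ifs <;> first
      | exact geom_pow_mul_pow_le hR (by omega)
      | (exfalso; omega)
      | (simp <;> positivity)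
  m4 := by
    intro a b; unfold geom
    have hR0 : (0 : ℝ) ≤ R := by linarith
    split_ifs <;> first
      | exact geom_pow_mul_pow_le hR (by omega)
      | (exfalso; omega)
      | (simp <;> positivity)

section Necessary

variable {n00 n10 n01 n20 n11 n02 n30 n21 n12 n03 : ℝ}

/-- FLAT SKELETON: if the ten-point convolution of the flat tail of level `6` is an M♮ tail, then
`(n00 − m₁)·S ≤ m₁²` (`m₁` = the level-one mass, `S` = the mass of the levels `≥ 2`) — the `m1`
inequality at the top-level base point `(3,3)`, where the convolution takes the values `S`, `M`,
`M − n00`, `M − n00` (`M` = the total mass) -/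
theorem hconv3_flat_top
    (h : IsMTail (hconv3 n00 n10 n01 n20 n11 n02 n30 n21 n12 n03 (flat 6)) 9) :
    (n00 - n10 - n01) * (n20 + n11 + n02 + n30 + n21 + n12 + n03) ≤ (n10 + n01) ^ 2 := by
  have hm := h.m1 3 3
  norm_num [hconv3, flat] at hm
  linear_combination hm

/-- GEOMETRIC SKELETON: if the ten-point convolution of the geometric level tail of ratio `R ≥ 1`
and level `6` is an M♮ tail, then `(n00 − R·m₁)(m₂ + R·m₃) ≤ m₁²` (`m_k` = the level-`k` masses) —
the `m1` inequality at the top-level base point `(3,3)` -/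
theorem hconv3_geom_top {R : ℝ}
    (h : IsMTail (hconv3 n00 n10 n01 n20 n11 n02 n30 n21 n12 n03 (geom R 6)) 9) :
    (n00 - R * (n10 + n01)) * ((n20 + n11 + n02) + R * (n30 + n21 + n12 + n03))
      ≤ (n10 + n01) ^ 2 := by
  have hm := h.m1 3 3
  norm_num [hconv3, geom] at hm
  rw [show Int.toNat 2 = 2 from rfl, show Int.toNat 3 = 3 from rfl] at hm
  linear_combination hm

/-- NECESSARY CONDITIONS for a max-flow-3 factor to preserve the class (to lie in `𝒴`): the two
skeleton inequalities, the geometric one for every real ratio `R ≥ 1` (`R = 1` is the flat one) -/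
theorem flow3_necessary
    (hY : ∀ (T : ℤ → ℤ → ℝ) (L : ℤ), IsMTail T L →
      IsMTail (hconv3 n00 n10 n01 n20 n11 n02 n30 n21 n12 n03 T) (L + 3)) :
    (n00 - n10 - n01) * (n20 + n11 + n02 + n30 + n21 + n12 + n03) ≤ (n10 + n01) ^ 2 ∧
    ∀ R : ℝ, 1 ≤ R →
      (n00 - R * (n10 + n01)) * ((n20 + n11 + n02) + R * (n30 + n21 + n12 + n03))
        ≤ (n10 + n01) ^ 2 := by
  refine ⟨hconv3_flat_top (hY _ 6 (flat_isMTail (by norm_num))), fun R hR => ?_⟩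
  exact hconv3_geom_top (hY _ 6 (geom_isMTail hR (by norm_num)))

end Necessary

section FlatTop

/-- at the top-level base point `(3,3)` of the flat tail of level `6`, the `m1` coefficient of the
pair `{(0,0),(1,2)}` (base points `(3,3)` and `(2,1)`) equals `1` -/
theorem flat_top_orphan_one :
    crossB1 (flat 6) 3 3 2 1 + crossB1 (flat 6) 2 1 3 3 = 1 := by
  norm_num [crossB1, flat]

/-- at the top-level base point `(3,3)` of the flat tail of level `6`, every pair of two points
`s`, `t` of the flow-3 triangle with both levels `≥ 2` has `m1` coefficient `0` — in particular
every signed pair containing a top-level point; together with `flat_top_orphan_one` this rules out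
any absorption inequality `c{(0,0),(1,2)} + Σ c(I) ≤ 0` over such pairs `I` -/
theorem flat_top_high_zero (s₁ s₂ t₁ t₂ : ℤ) (hs : 0 ≤ s₁) (hs' : 0 ≤ s₂) (ht : 0 ≤ t₁)
    (ht' : 0 ≤ t₂) (hs2 : 2 ≤ s₁ + s₂) (hs3 : s₁ + s₂ ≤ 3) (ht2 : 2 ≤ t₁ + t₂)
    (ht3 : t₁ + t₂ ≤ 3) :
    crossB1 (flat 6) (3 - s₁) (3 - s₂) (3 - t₁) (3 - t₂)
      + crossB1 (flat 6) (3 - t₁) (3 - t₂) (3 - s₁) (3 - s₂) = 0 := by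
  unfold crossB1 flat
  split_ifs <;> norm_num <;> omega

end FlatTop

section Orphan

variable {T : ℤ → ℤ → ℝ} {L : ℤ} (hT : IsMTail T L)
include hT

/-- the `m1` coefficient of the pair `{(0,0),(1,2)}` at the base point `(a,b)` is at most the
log-concavity defect `T(a,b)T(a,b−1) − T(a,b+1)T(a,b−2)` of the column through the base point: the
other bracket `T(a+1,b+1)T(a−1,b−2) − T(a+1,b)T(a−1,b−1)` is a `Δ₂`-cone instance (`d2_cone`) -/
lemma IsMTail.abs1_orphan_le (a b : ℤ) :
    crossB1 T a b (a - 1) (b - 2) + crossB1 T (a - 1) (b - 2) a b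
      ≤ T a b * T a (b - 1) - T a (b + 1) * T a (b - 2) := by
  unfold crossB1
  have h := hT.d2_cone (a := a - 1) (b := b - 2) (a' := a + 1) (b' := b) (by omega) (by omega)
  ring_nf at h ⊢
  linarith only [h]

end Orphan

end Summit.Ventures.PercRepro2.Tail2D
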